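import Mathlib.Tactic
import HarnessLib

/-!
# Kozma–Nitzan's Question 8 — UNI-C(U;y): the Λ-free A-death members behind LEMMA U′ (gen 40)

Support file (`--supports stmt-CriticalPhenomena-4575`, closed crux; independent mathematics on Kozma–Nitzan's Question 8,
arXiv:2401.12397 §5.5 p. 36), prover `prim-ineq-gen-6` (gen 40).  No definitions, no named facts, no sorries; standard axioms.
Memo `run/shared/lean/prim/prim-ineq-gen-6/PROOF-UNIC-LC-G40.md` §9 (LEMMA U′ ⟹ THEOREM U-AD).

At an A-death vertex `v` (`fa_{v−1} > 1`, `ζ = 1/fa`) of a C-hypothesis node `t` the two members are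
`JB_v = γ_{v−1}Λ·POST₂·u_{k₁}/Ω_v` and `KQ_v = γ_{v−1}Λ·q₃·u_{k₁}/KW_v` with `γ_{v−1}Λ ≤ 1/(C + (1−C)ζ)`, `C = C_[v,t]`,
`Ω_v ≥ C_[k₁,v−1]·M_v`, `KW_v ≥ (1−ǔ_v)·C_[k₁+1,v−1]·α·Φ·BR₁(v)`.  LEMMA U′ (`u_{k₁} ≤ C_[k₁,t] = C_[k₁,v−1]·C`) makes both
members Λ-FREE: `JB_v ≤ POST₂/M_v` and `KQ_v ≤ q₃/((1−ǔ_v)αΦ BR₁(v))` — the kernels below are exactly these two divisions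
(`kU_ratio`: `u ≤ C'·C` and `G ≤ 1/(C + (1−C)ζ)` give `G·u/C' ≤ 1`; `kU_member`: a member `G·B·u/V` with `V ≥ C'·W` is `≤ B/W`).
Exact link checks: lab-g40/g40/l15_lemU.py (LEMMA U′, (M1), (M2), the scalar pieces; census n ≤ 7, 0 failures); box certificate
lab-g40/g40/b04_boxU.py (`F_U ≤ 1/2`, 1 011 cells, exact leaf verification).
[cite: KozmaNitzan2024, Question 8 (§5.5 p. 36)]
-/

namespace Summit.CriticalPhenomena.PercolationContinuityZ3.Theorems

namespace PocketCert

/-- **The Λ·u cancellation.**  If `u ≤ C'·C` (LEMMA U′ split as `C_[k₁,t] = C_[k₁,v−1]·C_[v,t]`), `0 ≤ G ≤ 1/(C + (1−C)ζ)`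
(the flat bound of `γ_{v−1}Λ`), `0 ≤ ζ`, `0 ≤ C ≤ 1`, `0 < C'` and `0 < C + (1−C)ζ`, then `G·u/C' ≤ 1`.
[cite: KozmaNitzan2024, Question 8 (§5.5 p. 36)] -/
theorem kU_ratio (u C C' G ζ : ℝ) (hu : u ≤ C' * C) (hG0 : 0 ≤ G) (hG : G ≤ 1 / (C + (1 - C) * ζ))
    (hζ : 0 ≤ ζ) (hC0 : 0 ≤ C) (hC1 : C ≤ 1) (hC' : 0 < C') (hD : 0 < C + (1 - C) * ζ) :
    G * u / C' ≤ 1 := by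
  rw [div_le_one hC']
  have h1 : G * u ≤ G * (C' * C) := mul_le_mul_of_nonneg_left hu hG0
  have h2 : G * C ≤ 1 := by
    calc G * C ≤ 1 / (C + (1 - C) * ζ) * C := mul_le_mul_of_nonneg_right hG hC0
      _ = C / (C + (1 - C) * ζ) := by ring
      _ ≤ 1 := by
          rw [div_le_one hD]
          nlinarith [mul_nonneg (by linarith : (0:ℝ) ≤ 1 - C) hζ]
  nlinarith [mul_le_mul_of_nonneg_left h2 hC'.le]

/-- **Λ-free member.**  A member of the form `G·B·u/V` (`B ≥ 0` the budget scale — `POST₂` or `q₃` —, `V > 0` the visibility)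
with `V ≥ C'·W`, `W > 0`, and the cancellation `G·u/C' ≤ 1` (from `kU_ratio`) is at most `B/W`.
So under LEMMA U′: `JB_v ≤ POST₂/M_v` and `KQ_v ≤ q₃/((1−ǔ_v)·α·Φ·BR₁(v))` — no Λ, no DEN, no σ_v, no C-loss term.
[cite: KozmaNitzan2024, Question 8 (§5.5 p. 36)] -/
theorem kU_member (G B u V C' W : ℝ) (hB : 0 ≤ B) (hV : 0 < V) (hW : 0 < W) (hC' : 0 < C') (hVW : C' * W ≤ V)
    (hrat : G * u / C' ≤ 1) :
    G * B * u / V ≤ B / W := by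
  have h1 : G * u ≤ C' := by rwa [div_le_one hC'] at hrat
  rw [div_le_div_iff₀ hV hW]
  -- G B u W ≤ B V :  G u W ≤ C' W ≤ V
  have h2 : G * u * W ≤ C' * W := mul_le_mul_of_nonneg_right h1 hW.le
  have h3 : G * u * W ≤ V := le_trans h2 hVW
  nlinarith [mul_le_mul_of_nonneg_left h3 hB]

/-- **The two-member minimum is monotone in each visibility.**  With `0 ≤ P`, `0 ≤ Q`, `0 < M₀ ≤ M` and `0 < R₀ ≤ R`:
`min(P/M, Q/R) ≤ min(P/M₀, Q/R₀)` — the scalar box `F_U` evaluates the members at the cellwise lower bounds of `M_v` and of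
`(1−ǔ_v)·α·BR₁(v)`.
[cite: KozmaNitzan2024, Question 8 (§5.5 p. 36)] -/
theorem kU_min_mono (P Q M M₀ R R₀ : ℝ) (hP : 0 ≤ P) (hQ : 0 ≤ Q) (hM₀ : 0 < M₀) (hM : M₀ ≤ M) (hR₀ : 0 < R₀)
    (hR : R₀ ≤ R) :
    min (P / M) (Q / R) ≤ min (P / M₀) (Q / R₀) := by
  have h1 : P / M ≤ P / M₀ := div_le_div_of_nonneg_left hP hM₀ hM
  have h2 : Q / R ≤ Q / R₀ := div_le_div_of_nonneg_left hQ hR₀ hR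
  exact min_le_min h1 h2

end PocketCert

end Summit.CriticalPhenomena.PercolationContinuityZ3.Theorems
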